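import Mathlib
import Summits.Schanuel.Schanuel.Theses.RootDecomp1E
import Summits.Schanuel.Schanuel.Theorems.RootDecomp1EAnchorToolkit
import Summits.Schanuel.Schanuel.Theorems.RootDecomp1EAnchorDefs
import Summits.Schanuel.Schanuel.Theorems.RootDecomp1EEngineType
import Summits.Schanuel.Schanuel.Theorems.RootDecomp1EEngineTypeCells
import Summits.Schanuel.Schanuel.Theorems.RootDecomp1ELevels
import Literature.Barriers.Schanuel.AlgebraicIndependenceOfLogarithms
import Literature.NumberTheory.Transcendental.LindemannWeierstrassProofs

-- `Summit.Schanuel.Schanuel.…` is the mandated layout of this single-problem summit (CONVENTIONS §1).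

/-!
# RootDecomp1E — lens 2 «structural dichotomy (special vs generic)», gen 13: «UNSATURATED CORE»

NODE g13 for `route-Schanuel-RootDecomp1E` (rev 24). THEOREM ROUND (E-R13): no new registry item; this file
PROVES things about the live items and exhibits one certified OPEN member.

## The cut (special vs generic made EXACT at the root)

Round 1 of this lens cut Schanuel as `S ⟸ S⁻ ∧ Sat` with `S⁻ = DefectOneSchanuel` (stmt-25020, defect ≤ 1
everywhere) and `Sat = SaturatedSchanuel` (aside stmt-25021, Schanuel on SATURATED tuples — tuples whose
exponential field `F_z = ℚ(z, e^z)` sees no new `u ∉ span_ℚ z` with `u, e^u ∈ F_z^alg`). The GENERIC piece `S⁻`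
looked like a weakening of `S` over ALL tuples. THEOREM A below shows it is not: kernel-checked, for all `n`,

  `DefectOneSchanuel ↔ UnsaturatedSchanuel`   (`defectOne_iff_unsaturatedSchanuel`)

where `UnsaturatedSchanuel` is FULL Schanuel restricted to the UNSATURATED tuples (the exact complement of the
aside's locus). So the round-1 cut is an EXACT PARTITION of the summit by the saturation dichotomy:

  `Schanuel ↔ UnsaturatedSchanuel ∧ SaturatedSchanuel`,  `UnsaturatedSchanuel = DefectOneSchanuel`.

(→) a hull direction `u` of `w` gives the ℚ-free tuple `(u, w)` with the SAME exponential field up to algebraic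
extension, so `S⁻` at `(u, w)` is `S` at `w` (HULL COLLAPSE `trdeg_cons_eq_of_hull`); (←) induction on the length:
peel `z = (u, w)`; if `u` is a hull direction of `w`, `U(w)` and collapse give `n ≤ trdeg F_z`; if not, the
transcendence degree JUMPS (`trdeg_succ_le_cons_of_not_hull`, sandwich lemma of the toolkit) and the induction
hypothesis `S⁻(w)` finishes.

## The lens at the certified cells (COLLAPSE)

Instance-wise (`defectOneAt_cons_iff`): the `S⁻`-demand at a COMPRESSIBLE tuple `(u, w)` (`u, e^u ∈ F_w^alg`) is
LITERALLY the full-Schanuel demand at `w`. Every member of E-STABLE 31409 / PLAIN 31410 certified so far is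
compressible: `G = (πi, 1, i, π)` (gen 12) collapses onto LINDEMANN'S TRIPLE `(1, i, π)`:
`G-demand ↔ trdeg ℚ(π, e, eⁱ, e^π) ≥ 3 = S₃(1, i, π)` (`gQuadruple_collapse`); likewise `Q₃ ↔ S₃(√2·…)`,
Euler's/Nesterenko's triples `↔ S₂`-instances (decided: LW / Nesterenko). Printed neighbours of the collapsed
`G`-demand: «`e, π, e^π` algebraically independent» and «`π, e, eⁱ` a.i.» [Murty–Rath, Thm 21.3 context] each
imply it (`lindemann_demand_of_*`); the e-SIDE WALL: `e ∉ ℚ(π)` already gives `e + π ∉ ℚ` (`irrational_exp_one_add_pi_of_not_mem`).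

## (b″) Certified OPEN members of PLAIN 31410 that do NOT collapse: `M₁ = (1, iπ, log 2)` and THEOREM B

`logTwoTriple_mem_plainClass`: ℚ-free, NO irrational algebraic multiplier (indeed no irrational multiplier),
sub-minimal — membership BY THEOREM, hypothesis-free (Hermite–Lindemann via the tree theorem
`transcendental_exp_holds`, and `log 2 ∉ ℚ`). Its 31410-demand decodes (`logTwoTriple_demand_iff`) to

  `trdeg_ℚ ℚ(e, iπ, log 2) ≥ 2`  — «AT LEAST TWO OF `e, π, log 2` ARE ALGEBRAICALLY INDEPENDENT»,

OPEN (each pair is a famous open problem; the Gel'fond–Brownawell–Waldschmidt grid on `{e, iπ, log 2}` needs a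
fourth, closing exponential `κ = e^{iπ/log 2}`: `two_le_trdeg_e_piI_log_two_kappa` is the strongest known
statement, «two of `e, iπ, log 2, κ`», and the member's demand is that statement with `κ` removed — the B3
ceiling made explicit), and DECIDED modulo the registered printed conjecture
`Literature.Barriers.Schanuel.AlgIndepLogarithms` (algebraic independence of logarithms; weaker than `S`: tree
theorem `algIndepLogarithms_of_schanuel`): `logTwoTriple_demand_of_algIndepLogarithms`.

THEOREM B (`logPlaneTriple_mem_plainClass`, §6) makes this a FAMILY: for EVERY ℚ-linearly independent pair
`ℓ₁, ℓ₂` of logarithms of algebraic numbers, `(1, ℓ₁, ℓ₂)` is a member of 31410's class by theorem (key lemma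
`eq_zero_of_mem_span_logs`: `span_ℚ(ℓ₁, ℓ₂) ∩ ℚ̄ = 0`, Hermite–Lindemann after clearing denominators), and 31410
on the family IS the named statement `ELogPlane` («two of `e, ℓ₁, ℓ₂` are algebraically independent»), implied by
the two-variable case of `AlgIndepLogarithms` (`eLogPlane_of_algIndepLogarithms`) and by `S⁻`
(`eLogPlane_of_defectOne`); second instance `M₂ = (1, log 2, log 3)`. Unlike `G`, `Q₃`, `z♯`, `z★` and the
Euler/Nesterenko triples, no hull splitting of `M₁`/`M₂` is certifiable (`e ∈ ℚ(iπ, log 2)^alg`?, … are open), so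
these are the first certified members whose demand is a GENUINE defect-one statement rather than a full-Schanuel
instance one length down.

## Deciding theorem

`closes` below calls the LIVE `RootDecomp1E.closes` with `hD := defectOne_of_unsaturatedSchanuel hU`.

No `sorry`; no unsafe-reducibility options. Axioms of `closes`: `propext`, `Classical.choice`, `Quot.sound`.
-/

noncomputable section

namespace Summit.Schanuel.Schanuel.Theorems.RootDecomp1EUnsaturatedCore

open Complex IntermediateField
open Summit.Schanuel.Schanuel.Theses.RootDecomp1E (DefectOneSchanuel SaturatedSchanuel PlainDefectOne
  ClosedFormAtomSchanuel AlgAnchoredDarkAtomSchanuel LineLogDarkAtomSchanuel DeepLogDarkAtomSchanuel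
  OffAxisClosure FreeDarkAtomSchanuel)
open Summit.Schanuel.Schanuel.Theorems.RootDecomp1EAnchor (isAlgebraic_of_mem_adjoin trdeg_adjoin_le_of_isAlgebraic
  trdeg_le_of_mem_span trdeg_eq_of_span_eq isAlgebraic_of_trdeg_sandwich gens_cons_isAlgebraic Saturated)
open Summit.Schanuel.Schanuel.Theorems.RootDecomp1EEngineType (trdeg_eq_nat two_le_trdeg_of_algebraicIndependent
  algebraicIndependent_pi_exp_pi)
open Summit.Schanuel.Schanuel.Theorems.RootDecomp1EModuleGrids (subMinimal_three rat_mul_pi_eq_rat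
  rat_log_two_log_three_indep)
open Summit.Schanuel.Schanuel.Theorems.RootDecomp1EModuleType (SubMinimalDefect)
open Summit.Schanuel.Schanuel.Theorems.RootDecomp1ELevels (le_trdeg_of_algebraicIndependent)
open Literature.NumberTheory.Transcendental (transcendental_exp_holds nesterenko exists_nsmul_mem_span_int
  ExpOneAddPiIrrational ExpOnePiAlgebraicIndependent)
open Literature.Barriers.Schanuel (AlgIndepLogarithms algIndepLogarithms_of_schanuel linearIndependent_piI_log_two
  algebraicIndependent_piI_log_two_of_algIndepLogarithms gridField₂ smallTrdeg_thm_2_9_two_two)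

/-! ## §1 The dichotomy: saturated vs unsaturated tuples -/

/-- piece:def · `w` is UNSATURATED: it has a HULL DIRECTION `u ∉ span_ℚ w` with `u` and `e^u` algebraic over
`F_w = ℚ(w, e^w)` (the constructive negation of `RootDecomp1EAnchor.Saturated`). -/
def Unsaturated {m : ℕ} (w : Fin m → ℂ) : Prop :=
  ∃ u : ℂ, u ∉ Submodule.span ℚ (Set.range w) ∧
    IsAlgebraic ↥(adjoin ℚ (Set.range w ∪ Set.range (cexp ∘ w))) u ∧
    IsAlgebraic ↥(adjoin ℚ (Set.range w ∪ Set.range (cexp ∘ w))) (cexp u)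

/-- `Unsaturated w ↔ ¬ Saturated m w`. -/
theorem unsaturated_iff_not_saturated {m : ℕ} (w : Fin m → ℂ) : Unsaturated w ↔ ¬ Saturated m w := by
  unfold Unsaturated Saturated
  push Not
  constructor
  · rintro ⟨u, hu, ha, he⟩
    exact ⟨u, ha, he, hu⟩
  · rintro ⟨u, ha, he, hu⟩
    exact ⟨u, hu, ha, he⟩

/-- piece:crux-reading · **SCHANUEL ON THE UNSATURATED LOCUS**: full Schanuel `m ≤ trdeg F_w` for every ℚ-free
UNSATURATED `w`. THEOREM A: this is `DefectOneSchanuel` (stmt-25020) exactly. -/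
def UnsaturatedSchanuel : Prop :=
  ∀ (m : ℕ) (w : Fin m → ℂ), LinearIndependent ℚ w → Unsaturated w →
    (m : Cardinal) ≤ Algebra.trdeg ℚ ↥(adjoin ℚ (Set.range w ∪ Set.range (cexp ∘ w)))

/-! ## §2 Hull collapse and the non-hull jump -/

/-- The coordinates of `w` lie in `span_ℚ (u, w)`. -/
theorem tail_mem_span_cons {m : ℕ} (w : Fin m → ℂ) (u : ℂ) :
    ∀ j, w j ∈ Submodule.span ℚ (Set.range (Fin.cons u w : Fin (m + 1) → ℂ)) := fun j =>
  Submodule.subset_span ⟨j.succ, by simp⟩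

/-- The generators of `F_w` are among those of `F_{(u,w)}`. -/
theorem gens_subset_gens_cons {m : ℕ} (w : Fin m → ℂ) (u : ℂ) :
    Set.range w ∪ Set.range (cexp ∘ w) ⊆
      Set.range (Fin.cons u w : Fin (m + 1) → ℂ) ∪ Set.range (cexp ∘ (Fin.cons u w : Fin (m + 1) → ℂ)) := by
  rintro x (⟨j, rfl⟩ | ⟨j, rfl⟩)
  · exact Or.inl ⟨j.succ, by simp⟩
  · exact Or.inr ⟨j.succ, by simp⟩

/-- piece:proved · **HULL COLLAPSE.** Adjoining a hull direction does not move the transcendence degree: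
`u, e^u ∈ F_w^alg ⟹ trdeg F_{(u,w)} = trdeg F_w`. -/
theorem trdeg_cons_eq_of_hull {m : ℕ} (w : Fin m → ℂ) (u : ℂ)
    (hu : IsAlgebraic ↥(adjoin ℚ (Set.range w ∪ Set.range (cexp ∘ w))) u)
    (heu : IsAlgebraic ↥(adjoin ℚ (Set.range w ∪ Set.range (cexp ∘ w))) (cexp u)) :
    Algebra.trdeg ℚ ↥(adjoin ℚ (Set.range (Fin.cons u w : Fin (m + 1) → ℂ) ∪
        Set.range (cexp ∘ (Fin.cons u w : Fin (m + 1) → ℂ)))) =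
      Algebra.trdeg ℚ ↥(adjoin ℚ (Set.range w ∪ Set.range (cexp ∘ w))) :=
  le_antisymm (trdeg_adjoin_le_of_isAlgebraic (gens_cons_isAlgebraic _ w u le_rfl hu heu))
    (trdeg_le_of_mem_span (tail_mem_span_cons w u))

/-- piece:proved · **NON-HULL JUMP.** If `u` is NOT a hull direction of `w` (one of `u`, `e^u` is transcendental
over `F_w`), the transcendence degree jumps: `trdeg F_w + 1 ≤ trdeg F_{(u,w)}` (sandwich lemma). -/
theorem trdeg_succ_le_cons_of_not_hull {m : ℕ} (w : Fin m → ℂ) (u : ℂ)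
    (h : ¬ (IsAlgebraic ↥(adjoin ℚ (Set.range w ∪ Set.range (cexp ∘ w))) u ∧
      IsAlgebraic ↥(adjoin ℚ (Set.range w ∪ Set.range (cexp ∘ w))) (cexp u))) :
    Algebra.trdeg ℚ ↥(adjoin ℚ (Set.range w ∪ Set.range (cexp ∘ w))) + 1 ≤
      Algebra.trdeg ℚ ↥(adjoin ℚ (Set.range (Fin.cons u w : Fin (m + 1) → ℂ) ∪
        Set.range (cexp ∘ (Fin.cons u w : Fin (m + 1) → ℂ)))) := by
  obtain ⟨tw, htw, -⟩ := trdeg_eq_nat w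
  obtain ⟨tz, htz, -⟩ := trdeg_eq_nat (Fin.cons u w : Fin (m + 1) → ℂ)
  have hmono : Algebra.trdeg ℚ ↥(adjoin ℚ (Set.range w ∪ Set.range (cexp ∘ w))) ≤
      Algebra.trdeg ℚ ↥(adjoin ℚ (Set.range (Fin.cons u w : Fin (m + 1) → ℂ) ∪
        Set.range (cexp ∘ (Fin.cons u w : Fin (m + 1) → ℂ)))) :=
    trdeg_le_of_mem_span (tail_mem_span_cons w u)
  have hT0 := htz
  rw [htw, htz] at hmono ⊢
  have hle : tw ≤ tz := by exact_mod_cast hmono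
  by_cases hlt : tw < tz
  · exact_mod_cast (show tw + 1 ≤ tz by omega)
  · exfalso
    have hT : Algebra.trdeg ℚ ↥(adjoin ℚ (Set.range (Fin.cons u w : Fin (m + 1) → ℂ) ∪
        Set.range (cexp ∘ (Fin.cons u w : Fin (m + 1) → ℂ)))) ≤ (tw : Cardinal) := by
      rw [hT0]
      exact_mod_cast (show tz ≤ tw by omega)
    have hS : (tw : Cardinal) ≤ Algebra.trdeg ℚ ↥(adjoin ℚ (Set.range w ∪ Set.range (cexp ∘ w))) := htw.ge
    exact h ⟨isAlgebraic_of_trdeg_sandwich (subset_adjoin ℚ _ (Or.inl ⟨0, by simp⟩))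
        (gens_subset_gens_cons w u) hT hS,
      isAlgebraic_of_trdeg_sandwich (subset_adjoin ℚ _ (Or.inr ⟨0, by simp⟩))
        (gens_subset_gens_cons w u) hT hS⟩

/-- piece:proved · instance-wise COLLAPSE: at a compressible tuple `(u, w)` the `S⁻`-demand (defect ≤ 1 at
length `m + 1`) is LITERALLY the full-Schanuel demand at `w` (defect `0` at length `m`). -/
theorem defectOneAt_cons_iff {m : ℕ} (w : Fin m → ℂ) (u : ℂ)
    (hu : IsAlgebraic ↥(adjoin ℚ (Set.range w ∪ Set.range (cexp ∘ w))) u)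
    (heu : IsAlgebraic ↥(adjoin ℚ (Set.range w ∪ Set.range (cexp ∘ w))) (cexp u)) :
    (((m + 1 : ℕ) : Cardinal) ≤ Algebra.trdeg ℚ ↥(adjoin ℚ (Set.range (Fin.cons u w : Fin (m + 1) → ℂ) ∪
        Set.range (cexp ∘ (Fin.cons u w : Fin (m + 1) → ℂ)))) + 1) ↔
      ((m : Cardinal) ≤ Algebra.trdeg ℚ ↥(adjoin ℚ (Set.range w ∪ Set.range (cexp ∘ w)))) := by
  rw [trdeg_cons_eq_of_hull w u hu heu]
  obtain ⟨t, ht, -⟩ := trdeg_eq_nat w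
  rw [ht]
  constructor
  · intro h
    have : m + 1 ≤ t + 1 := by exact_mod_cast h
    exact_mod_cast (show m ≤ t by omega)
  · intro h
    have : m ≤ t := by exact_mod_cast h
    exact_mod_cast (show m + 1 ≤ t + 1 by omega)

/-! ## §3 THEOREM A: `DefectOneSchanuel ↔ UnsaturatedSchanuel`; the exact partition of the summit -/

/-- piece:proved · `S⁻ ⟹ U`: a hull direction `u` of a ℚ-free `w` makes `(u, w)` ℚ-free with the same
transcendence degree, so defect `≤ 1` at `(u, w)` is defect `0` at `w`. -/
theorem unsaturatedSchanuel_of_defectOne (hD : DefectOneSchanuel) : UnsaturatedSchanuel := by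
  intro m w hw hun
  obtain ⟨u, hu, halg, healg⟩ := hun
  have hz : LinearIndependent ℚ (Fin.cons u w : Fin (m + 1) → ℂ) := linearIndependent_finCons.2 ⟨hw, hu⟩
  exact (defectOneAt_cons_iff w u halg healg).1 (hD (m + 1) (Fin.cons u w) hz)

/-- piece:proved · `U ⟹ S⁻`, by induction on the length (peel one coordinate; collapse or jump). -/
theorem defectOne_of_unsaturatedSchanuel (hU : UnsaturatedSchanuel) : DefectOneSchanuel := by
  intro n
  induction n with
  | zero =>
    intro z _
    simp
  | succ m ih =>
    intro z hz
    obtain ⟨u, w, rfl⟩ : ∃ (u : ℂ) (w : Fin m → ℂ), z = Fin.cons u w :=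
      ⟨z 0, Fin.tail z, (Fin.cons_self_tail z).symm⟩
    have hw : LinearIndependent ℚ w := (linearIndependent_finCons.1 hz).1
    have hu : u ∉ Submodule.span ℚ (Set.range w) := (linearIndependent_finCons.1 hz).2
    by_cases hh : IsAlgebraic ↥(adjoin ℚ (Set.range w ∪ Set.range (cexp ∘ w))) u ∧
        IsAlgebraic ↥(adjoin ℚ (Set.range w ∪ Set.range (cexp ∘ w))) (cexp u)
    · exact (defectOneAt_cons_iff w u hh.1 hh.2).2 (hU m w hw ⟨u, hu, hh.1, hh.2⟩)
    · have h2 := trdeg_succ_le_cons_of_not_hull w u hh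
      have h3 := ih w hw
      calc ((m + 1 : ℕ) : Cardinal)
          = (m : Cardinal) + 1 := by push_cast; rfl
        _ ≤ Algebra.trdeg ℚ ↥(adjoin ℚ (Set.range w ∪ Set.range (cexp ∘ w))) + 1 + 1 :=
          add_le_add h3 le_rfl
        _ ≤ _ := add_le_add h2 le_rfl

/-- piece:proved · **THEOREM A.** `DefectOneSchanuel` (stmt-25020) IS Schanuel on the unsaturated locus. -/
theorem defectOne_iff_unsaturatedSchanuel : DefectOneSchanuel ↔ UnsaturatedSchanuel :=
  ⟨unsaturatedSchanuel_of_defectOne, defectOne_of_unsaturatedSchanuel⟩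

/-- piece:proved · the round-1 cut of this lens is an EXACT PARTITION of the summit by the saturation
dichotomy: `Schanuel ↔ UnsaturatedSchanuel ∧ SaturatedSchanuel` (the aside stmt-25021 is the other cell). -/
theorem schanuel_iff_unsaturated_and_saturated :
    _root_.Schanuel ↔ UnsaturatedSchanuel ∧ SaturatedSchanuel := by
  constructor
  · intro hS
    exact ⟨fun m w hw _ => hS m w hw, fun n z hz _ => hS n z hz⟩
  · rintro ⟨hU, hSat⟩ n z hz
    by_cases hs : Saturated n z
    · exact hSat n z hz hs
    · exact hU n z hz ((unsaturated_iff_not_saturated z).2 hs)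

/-- … equivalently `Schanuel ↔ DefectOneSchanuel ∧ SaturatedSchanuel` with BOTH conjuncts exact restrictions
of `S` to complementary loci (round 1 had only `⟸`). -/
theorem schanuel_iff_defectOne_and_saturated :
    _root_.Schanuel ↔ DefectOneSchanuel ∧ SaturatedSchanuel := by
  rw [defectOne_iff_unsaturatedSchanuel]
  exact schanuel_iff_unsaturated_and_saturated

end Summit.Schanuel.Schanuel.Theorems.RootDecomp1EUnsaturatedCore
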